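import Summits.QuantumFields.YangMills.Theorems.UnitScaleTiltProp7GreenPiGradientFamily
import Summits.QuantumFields.YangMills.Theorems.UnitScaleTiltProp7H133FamilyPackage
import Summits.QuantumFields.YangMills.Theorems.UnitScaleTiltProp7NormHpiOfKernel133
import Summits.QuantumFields.YangMills.Theorems.UnitScaleTiltProp7KinvSupRowOfKernelRow
import Summits.QuantumFields.YangMills.Theorems.UnitScaleTiltProp7QTwSColumnBound
import HarnessLib

/-!
# Route `UnitScaleTilt`, crux K1 «MinimiserStabilityRegPr» (stmt-QuantumFields-19200), EX row (2) `norm_Hπ` — NORM-Hπ-PKG part 2∕2: **THE S47 ROW `norm_Hπ` FOR ALL MEMBERS AS ONE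
# `∃`-PACKAGE** — `hGpi_family_exists` = the Hπ-DOOR's gradient letter `hGπ` (px21 ✓`Prop7GreenPiGradientRowOfLetters.gradient_row_HT_of_gradient_row` at the Π-slot) at every member over
# part 1 ✓`Prop7GreenPiGradientFamily.gradient_GTpi_family_exists` ((∇π) row), the `Q_k†` sup row ✓`Prop7QTwSColumnBound.norm_toL2_symm_adjoint_Qk_apply_le_of_regPr` (`∝ (cB∕c₀)ℓ⁻³`) and
# px10's K6-Π ✓`Prop7KinvPiFamilyPackage.kinvRow_pi_family_exists` read as a sup row by px17's ✓`Prop7KinvSupRowOfKernelRow.supRow_KinvT_of_kernelRow` (`∝ (c₀∕cB)ℓ³`) — the product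
# `CQ·CK` is L-ONLY by the cancellation `(cB∕c₀)ℓ⁻³·(c₀∕cB)ℓ³ = 1` (the H-DOOR's bookkeeping); and `normHpi_family_exists` = px21 ✓`Prop7NormHpiOfKernel133`'s member door
# ✓`norm_H1f_le_of_kernelRow_of_gradLetter` over px10 ✓`Prop7H133FamilyPackage.h133_family_exists` (row (1)) and `hGpi_family_exists` ⟹ S47's `norm_Hπ` ROW TEXT at EVERY member under
# `RegPr ∧ cap ∧ Lift ∧ ROOM ∧ coupling window` — the row (2) socket (✓p776003's `∃`-head and antecedent order VERBATIM; ROOM displayed while the inputs carry it, R-edition by generator).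
# (width seat `ym3-torus-px21` g16; CLAIM 14:50:12Z.)

Cell `ym3-torus` (HUMAN RULING D-0037; rung R3 = SU(2) YM₃ on T³ — NOT d = 4, NOT infinite volume, NOT a mass gap, NOT Clay).  THEOREMS ONLY (0 `def`, 0 `sorry`);
`--supports stmt-QuantumFields-19200 --as helper`; count-neutral.

WHAT IS PROVED (ns `Summit.QuantumFields.YangMills.Theorems.Prop7NormHpiFamilyPackage`).  For positive L-only weights `c₀ cB : ℕ → ℝ` and a coupling window `0 < a₀ ≤ a₁`:
* §1 ★ `qdag_supRow_member` — the `Q_k†` sup row at a member `i : Idx L` with its constant spelled L-ONLY × `(cB L∕c₀ L)·(L^{K−n})⁻³` (`(F.P K).d = 3`, `(F.P K).L = F.L = L`).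
* §2 ★★★ `hGpi_family_exists` — `∃ αM MG : ℕ → ℝ` (cap with the three windows of record, `αM L ≤ 1`, `0 ≤ MG L`) such that for every `L > 1`, `i : Idx L`, `U₀` with `RegPr ρ U₀`, `ρ ≤ αM L`,
  under `Lift`, ROOM, every coupling in the window: the Hπ-DOOR's `hGπ` TEXT `∀ b, ‖nabla115 ((L⁻¹)^(K−n)) (bgOfCfg U₀) (fun q => toL2⁻¹(H_π(toL2B b)) (bondEquiv⁻¹ q))‖ ≤ MG L * ‖b‖`,
  `H_π = HT … a (DeltaPiSlotP … a) U₀`, `MG L := BGπ L·(6·Q_L·CPi L·(2(1+1∕μPi L))³)` ([Balaban1985BackgroundPropagators] (3.133)₂ for (3.126), every member, L-only).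
* §3 ★★★ `normHpi_family_exists` — `∃ αN B₀ : ℕ → ℝ` (same caps, `0 ≤ B₀ L`) with, per member under the same antecedents, **S47's `norm_Hπ` ROW TEXT**
  `∀ b, ‖H1f … a (DeltaPiSlotP … a) U₀ b‖ ≤ B₀ L * ‖b‖`, `B₀ L := max (3·CH L·(2(1+1∕(δH L∕2)))³) (MG L)` ([Balaban1985BackgroundPropagators] Thm 3.12 (3.42) for `H` (3.126)∕[Balaban1985Variational] (117)).
HYP-SAT (★★OWNER RULING №42).  Nothing displayed beyond `RegPr`∕cap∕`Lift`∕ROOM∕coupling window (classes of record; ROOM = the inputs' T1∕interpolant antecedent, removable by their `_allMembers`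
editions); constants EXISTENTIAL-but-L-only; conclusions non-vacuous; no `Prop` placeholder.
HONEST SCOPE.  An `∃`-assembly over landed packages (no estimate proved here); nothing of rows (1)(3)–(8), `hThm2S`, EX `stub_existenceMinimalOrbit`, 19200 or the rung is proved; no summit
is proved by a helper; the Yang–Mills mass gap is NOT proved.

References: T. Bałaban, CMP **99** (1985) 389–434 [Balaban1985BackgroundPropagators] ((3.16) p.393, (3.122)–(3.126) p.420, (3.130)–(3.133) pp.421–422, Thm 3.12 (3.42) p.423);
CMP **102** (1985) 277–309 [Balaban1985Variational] (Thm 1 p.279, (44)–(46) p.285, (103) p.293, (115)–(117) pp.294–295).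
-/

set_option autoImplicit false

noncomputable section

open scoped Matrix.Norms.L2Operator BigOperators InnerProductSpace ComplexConjugate

namespace Summit.QuantumFields.YangMills.Theorems.Prop7NormHpiFamilyPackage

open Literature.MathematicalPhysics.QuantumFieldTheory.Balaban1983to89
open Literature.MathematicalPhysics.QuantumFieldTheory.Balaban1983to89.T3ContinuumYM3Torus
open Literature.MathematicalPhysics.QuantumFieldTheory.Balaban1983to89.T3PrintedRegularMinimiser (RegPr)
open Literature.MathematicalPhysics.QuantumFieldTheory.Balaban1983to89.T3PrintedMinimiserExistence (regPr_mono)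
open T3LevelShift (siteShift)
open T3PrintedRegularOrbits (sites_eq)
open B15DeterminingSets (embIter)
open T3SectALandauChart (bgUnits)
open B9SectCLatticeCarrier (Bond)
open B9Eq311L2Pairing (WL2)
open B11Eq90V0primeCurrent (flat115)
open B11Eq111FrakG (nabla115)
open B11Eq103H1Complex (SiteL2K BondL2K)
open B5Eq118OneStroke (iterBlockOf)
open Summit.QuantumFields.YangMills.Theorems.Prop8Chart (emlIterU)
open Summit.QuantumFields.YangMills.Theorems.Prop7SectET3Transport (periodsT3 bondEquiv bgOfCfg)
open Summit.QuantumFields.YangMills.Theorems.Prop7SectET3HilbertLetters (W₂ toL2 toL2S toL2B DL2 DstarL2)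
open Summit.QuantumFields.YangMills.Theorems.Prop7SectET3WilsonHessian (DeltaEtaSlot)
open Summit.QuantumFields.YangMills.Theorems.Prop7SectET3CurvedPropagators (Qk GT PosOnto HT H1f KinvT)
open Summit.QuantumFields.YangMills.Theorems.Prop7SectET3DeltaPiPInv (DeltaPiSlotP)
open Summit.QuantumFields.YangMills.Theorems.Prop7OneFormCoerciveHolds (hco_DeltaPiSlotP_exists posOnto_of_coercive)
open Summit.QuantumFields.YangMills.Theorems.Prop7GreenPiGradientFamily (gradient_GTpi_family_exists)
open Summit.QuantumFields.YangMills.Theorems.Prop7GreenPiGradientRowOfLetters (gradient_row_HT_of_gradient_row)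
open Summit.QuantumFields.YangMills.Theorems.Prop7QTwSColumnBound (norm_toL2_symm_adjoint_Qk_apply_le_of_regPr)
open Summit.QuantumFields.YangMills.Theorems.Prop7KinvSupRowOfKernelRow (supRow_KinvT_of_kernelRow)
open Summit.QuantumFields.YangMills.Theorems.Prop7KinvPiFamilyPackage (kinvRow_pi_family_exists)
open Summit.QuantumFields.YangMills.Theorems.Prop7H133FamilyPackage (h133_family_exists)
open Summit.QuantumFields.YangMills.Theorems.Prop7Kernel133DoorOfKinvRow (flat115_H1f_apply)
open Summit.QuantumFields.YangMills.Theorems.Prop7HTValueRowOfKernel (norm_H1f_le_of_kernelRow_of_gradLetter)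

/-! ## §1 The `Q_k†` sup row at a member, constant read L-only × `(cB∕c₀)ℓ⁻³` -/

/-- ★ **THE `Q_k†` SUP ROW AT A MEMBER `i : Idx L`** — ✓`norm_toL2_symm_adjoint_Qk_apply_le_of_regPr` with `(F.P K).d = 3`, `(F.P K).L = F.L = L` spelled out, so that the constant is an
L-only real times `(cB L∕c₀ L)·((L:ℝ)^(K−n))⁻¹^3`. [cite: Balaban1985BackgroundPropagators, p.391, (3.16) p.393; Balaban1985Variational, (44)–(45) p.285] -/
theorem qdag_supRow_member (c₀ cB : ℕ → ℝ) [hc₀ : ∀ L : ℕ, Fact (0 < c₀ L)] [hcB : ∀ L : ℕ, Fact (0 < cB L)]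
    (L : ℕ) (i : T3Thm1Carrier.Idx L) {ε₀ : ℝ} (hε₀ : 0 < ε₀) (hW10 : 10 ^ 10 * (L : ℝ) ^ 6 * ε₀ ≤ 1) (hW12 : 10 ^ 12 * (L : ℝ) ^ 3 * ε₀ ≤ 1)
    (U₀ : GaugeField (i.1.1.P i.1.2.2) 0 (Matrix.specialUnitaryGroup (Fin 2) ℂ)) (hreg : RegPr i.1.1 i.1.2.1 i.1.2.2 ε₀ U₀) :
    ∀ (Y : PBond (i.1.1.P i.1.2.1) 0 → Matrix (Fin 2) (Fin 2) ℂ) (bd : PBond (i.1.1.P i.1.2.2) 0),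
      ‖(toL2 i.1.1 i.1.2.2 (c₀ L)).symm (LinearMap.adjoint (Qk i.1.1 i.1.2.1 i.1.2.2 i.2.2.le (c₀ L) (cB L) U₀) (toL2B i.1.1 i.1.2.1 (cB L) Y)) bd‖
        ≤ (2 * (Real.sqrt 2 * (2 * Real.exp ((159 * ((((3 : ℕ) + 2) * L : ℕ) : ℝ) * (2 * ((3 : ℕ) : ℝ))) / (((L : ℝ) ^ (3 : ℕ))⁻¹ * (L : ℝ)) * (((((3 : ℕ) + 2) * L : ℕ) : ℝ) ^ 2 / 16 * ε₀)) + 1))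
            * (cB L / c₀ L) * ((L : ℝ) ^ (i.1.2.2 - i.1.2.1))⁻¹ ^ 3) * ‖Y‖ := by
  intro Y bd
  have hLL : (L : ℝ) = (i.1.1.L : ℝ) := by rw [i.2.1]
  have hW10' : 10 ^ 10 * (i.1.1.L : ℝ) ^ 6 * ε₀ ≤ 1 := by rw [← hLL]; exact hW10
  have hW12' : 10 ^ 12 * (i.1.1.L : ℝ) ^ 3 * ε₀ ≤ 1 := by rw [← hLL]; exact hW12
  -- the lemma, with `(F.P K).d`, `(F.P K).L` unfolded by `rfl` (`P_d`, `P_L`)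
  have h : ‖(toL2 i.1.1 i.1.2.2 (c₀ L)).symm (LinearMap.adjoint (Qk i.1.1 i.1.2.1 i.1.2.2 i.2.2.le (c₀ L) (cB L) U₀) (toL2B i.1.1 i.1.2.1 (cB L) Y)) bd‖
      ≤ 2 * (Real.sqrt 2 * (2 * Real.exp ((159 * ((((3 : ℕ) + 2) * i.1.1.L : ℕ) : ℝ) * (2 * ((3 : ℕ) : ℝ))) / (((i.1.1.L : ℝ) ^ (3 : ℕ))⁻¹ * (i.1.1.L : ℝ)) * (((((3 : ℕ) + 2) * i.1.1.L : ℕ) : ℝ) ^ 2 / 16 * ε₀)) + 1))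
          * (cB L / c₀ L) * ((i.1.1.L : ℝ) ^ (i.1.2.2 - i.1.2.1))⁻¹ ^ 3 * ‖Y‖ :=
    norm_toL2_symm_adjoint_Qk_apply_le_of_regPr i.1.1 i.2.2.le (c₀ L) (cB L) hε₀ hW10' hW12' U₀ hreg Y bd
  -- read the member's `F.L` as `L` on the REAL side only (`i.2.1 : i.1.1.L = L`)
  have e1 : ((i.1.1.L : ℕ) : ℝ) = (L : ℝ) := by rw [i.2.1]
  have e2 : ((((3 : ℕ) + 2) * i.1.1.L : ℕ) : ℝ) = ((((3 : ℕ) + 2) * L : ℕ) : ℝ) := by rw [i.2.1]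
  refine h.trans (le_of_eq ?_)
  rw [e2, e1]

/-! ## §2 ★★★ The Hπ-DOOR's gradient letter `hGπ` for all members -/

/-- ★★★ **`hGπ` FOR ALL MEMBERS WITH ROOM, L-ONLY CONSTANTS** — ✓`gradient_row_HT_of_gradient_row` at the Π-slot of every member over part 1's (∇π) family, §1's `Q_k†` row and K6-Π's kernel row
read as a sup row (✓`supRow_KinvT_of_kernelRow`); the product of the two K-storey constants is L-only (`(cB∕c₀)ℓ⁻³·(c₀∕cB)ℓ³ = 1`).
[cite: Balaban1985BackgroundPropagators, (3.126) p.420, (3.130)–(3.133) pp.421–422, Thm 3.12 p.423; Balaban1985Variational, Thm 1 p.279, (45)–(46) p.285, (115)–(117) pp.294–295] -/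
theorem hGpi_family_exists (c₀ cB : ℕ → ℝ) [hc₀ : ∀ L : ℕ, Fact (0 < c₀ L)] [hcB : ∀ L : ℕ, Fact (0 < cB L)] {a₀ a₁ : ℝ} (ha₀ : 0 < a₀) (ha₀₁ : a₀ ≤ a₁) :
    ∃ (αM MG : ℕ → ℝ),
      (∀ L : ℕ, 1 < L → 0 < αM L) ∧ (∀ L : ℕ, 1 < L → 10 ^ 12 * (L : ℝ) ^ 3 * αM L ≤ 1) ∧ (∀ L : ℕ, 1 < L → 10 ^ 10 * (L : ℝ) ^ 6 * αM L ≤ 1) ∧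
      (∀ L : ℕ, 1 < L → 13 * 10 ^ 14 * (L : ℝ) ^ 3 * αM L ≤ 1) ∧ (∀ L : ℕ, 1 < L → αM L ≤ 1) ∧ (∀ L : ℕ, 1 < L → 0 ≤ MG L) ∧
    ∀ (L : ℕ), 1 < L → ∀ (i : T3Thm1Carrier.Idx L) (U₀ : GaugeField (i.1.1.P i.1.2.2) 0 (Matrix.specialUnitaryGroup (Fin 2) ℂ)), ∀ ρ : ℝ, RegPr i.1.1 i.1.2.1 i.1.2.2 ρ U₀ → ρ ≤ αM L →
        (∀ cf : Site (i.1.1.P i.1.2.2) (i.1.2.2 - i.1.2.1) → Matrix (Fin 2) (Fin 2) ℂ,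
        (∀ e' : PBond (i.1.1.P i.1.2.2) (i.1.2.2 - i.1.2.1), cf e'.src = ((emlIterU (i.1.2.2 - i.1.2.1) (bgUnits i.1.1 i.1.2.2 U₀) e' : (Matrix (Fin 2) (Fin 2) ℂ)ˣ) : Matrix (Fin 2) (Fin 2) ℂ) * cf e'.tgt *
        (((emlIterU (i.1.2.2 - i.1.2.1) (bgUnits i.1.1 i.1.2.2 U₀) e')⁻¹ : (Matrix (Fin 2) (Fin 2) ℂ)ˣ) : Matrix (Fin 2) (Fin 2) ℂ)) →
        ∃ l₀ : Site (i.1.1.P i.1.2.2) 0 → Matrix (Fin 2) (Fin 2) ℂ,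
        (∀ b' : PBond (i.1.1.P i.1.2.2) 0, l₀ b'.src = ((bgUnits i.1.1 i.1.2.2 U₀ b' : (Matrix (Fin 2) (Fin 2) ℂ)ˣ) : Matrix (Fin 2) (Fin 2) ℂ) * l₀ b'.tgt * (((bgUnits i.1.1 i.1.2.2 U₀ b')⁻¹ : (Matrix (Fin 2) (Fin 2) ℂ)ˣ) : Matrix (Fin 2) (Fin 2) ℂ)) ∧
        ∀ y : Site (i.1.1.P i.1.2.2) (i.1.2.2 - i.1.2.1), l₀ (embIter (i.1.2.2 - i.1.2.1) y) = cf y) →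
      2 * (12 * i.1.1.L ^ (i.1.2.2 - i.1.2.1) + 5) ≤ (i.1.1.P i.1.2.2).sitesPerDir 0 →
      ∀ a : ℝ, a₀ * (c₀ L / cB L) * ((i.1.1.L : ℝ) ^ (i.1.2.2 - i.1.2.1)) ^ 3 ≤ a → a ≤ a₁ * (c₀ L / cB L) * ((i.1.1.L : ℝ) ^ (i.1.2.2 - i.1.2.1)) ^ 3 →
      ∀ b : PBond (i.1.1.P i.1.2.1) 0 → Matrix (Fin 2) (Fin 2) ℂ,
        ‖nabla115 (((i.1.1.L : ℝ)⁻¹) ^ (i.1.2.2 - i.1.2.1)) (bgOfCfg i.1.1 i.1.2.2 U₀)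
            (fun q : Bond 3 (periodsT3 i.1.1 i.1.2.2) => (toL2 i.1.1 i.1.2.2 (c₀ L)).symm
              (HT i.1.1 i.1.2.1 i.1.2.2 i.2.2.le (c₀ L) (cB L) a (DeltaPiSlotP i.1.1 i.1.2.1 i.1.2.2 i.2.2.le (c₀ L) (cB L) a) U₀ (toL2B i.1.1 i.1.2.1 (cB L) b))
              ((bondEquiv i.1.1 i.1.2.2).symm q))‖ ≤ MG L * ‖b‖ := by
  classical
  obtain ⟨αG, BGπ, hαG, hWG12, hWG10, hWG13, hαG1, hBGπ, hGrow⟩ := gradient_GTpi_family_exists c₀ cB ha₀ ha₀₁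
  obtain ⟨αPi, CPi, μPi, hαPi, hWPi12, hWPi10, hWPi13, hαPi1, hCPi, hμPi, hKπ⟩ := kinvRow_pi_family_exists c₀ cB ha₀ ha₀₁
  obtain ⟨αcp, γcp, hαcp, hWcp, hwincp, hγcp, hcp⟩ := hco_DeltaPiSlotP_exists c₀ cB ha₀
  set αM : ℕ → ℝ := fun L => min (αG L) (min (αPi L) (αcp L)) with hαM
  have hαM0 : ∀ L : ℕ, 1 < L → 0 < αM L := fun L hL => by
    have := hαG L hL; have := hαPi L hL; have := hαcp L hL
    simp only [hαM]; exact lt_min (by assumption) (lt_min (by assumption) (by assumption))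
  have hαMG : ∀ L, αM L ≤ αG L := fun L => min_le_left _ _
  have hαMPi : ∀ L, αM L ≤ αPi L := fun L => (min_le_right _ _).trans (min_le_left _ _)
  have hαMcp : ∀ L, αM L ≤ αcp L := fun L => (min_le_right _ _).trans (min_le_right _ _)
  refine ⟨αM, fun L => BGπ L * (3 * (2 * (Real.sqrt 2 * (2 * Real.exp ((159 * ((((3 : ℕ) + 2) * L : ℕ) : ℝ) * (2 * ((3 : ℕ) : ℝ))) / (((L : ℝ) ^ (3 : ℕ))⁻¹ * (L : ℝ)) * (((((3 : ℕ) + 2) * L : ℕ) : ℝ) ^ 2 / 16 * αM L)) + 1))) * CPi L * (2 * (1 + 1 / μPi L)) ^ 3),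
    hαM0, fun L hL => ?_, fun L hL => ?_, fun L hL => ?_, fun L hL => (hαMG L).trans (hαG1 L hL), fun L hL => ?_, ?_⟩
  · exact (mul_le_mul_of_nonneg_left (hαMG L) (by positivity)).trans (hWG12 L hL)
  · exact (mul_le_mul_of_nonneg_left (hαMG L) (by positivity)).trans (hWG10 L hL)
  · exact (mul_le_mul_of_nonneg_left (hαMG L) (by positivity)).trans (hWG13 L hL)
  · have := hBGπ L hL; have := hCPi L hL; have := hμPi L hL; have := (hαM0 L hL).le
    positivity
  -- the member
  intro L hL i U₀ ρ hreg hρ hlift hroom a ha₀a ha₁a b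
  have hc₀L : 0 < c₀ L := (hc₀ L).out
  have hcBL : 0 < cB L := (hcB L).out
  have hL0 : (0 : ℝ) < L := by exact_mod_cast lt_trans zero_lt_one hL
  have hLL : (L : ℝ) = (i.1.1.L : ℝ) := by rw [i.2.1]
  have hαL := hαM0 L hL
  have ha : 0 ≤ a := le_trans (by positivity) ha₀a
  have hregM : RegPr i.1.1 i.1.2.1 i.1.2.2 (αM L) U₀ := regPr_mono i.1.1 hρ hreg
  have hW10 : 10 ^ 10 * (L : ℝ) ^ 6 * αM L ≤ 1 := (mul_le_mul_of_nonneg_left (hαMG L) (by positivity)).trans (hWG10 L hL)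
  have hW12 : 10 ^ 12 * (L : ℝ) ^ 3 * αM L ≤ 1 := (mul_le_mul_of_nonneg_left (hαMG L) (by positivity)).trans (hWG12 L hL)
  have hw13 : 13 * 10 ^ 14 * (i.1.1.L : ℝ) ^ 3 * αM L ≤ 1 := by
    rw [← hLL]; exact (mul_le_mul_of_nonneg_left (hαMcp L) (by positivity)).trans (hwincp L hL)
  -- PosOnto at the Π-slot
  have hpπ : PosOnto i.1.1 i.1.2.1 i.1.2.2 i.2.2.le (c₀ L) (cB L) a (DeltaPiSlotP i.1.1 i.1.2.1 i.1.2.2 i.2.2.le (c₀ L) (cB L) a) U₀ :=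
    posOnto_of_coercive i.2.2.le (cB L) i.2.2 hregM hw13 (hγcp L hL) _ (hcp L hL i U₀ ρ hreg (hρ.trans (hαMcp L)) hlift a ha₀a)
  -- the three letters
  have hG := hGrow L hL i U₀ ρ hreg (hρ.trans (hαMG L)) hlift hroom a ha₀a ha₁a
  have hQ := qdag_supRow_member c₀ cB L i hαL hW10 hW12 U₀ hregM
  have hCK0 : 0 ≤ CPi L * ((c₀ L / cB L) * ((L : ℝ) ^ (i.1.2.2 - i.1.2.1)) ^ 3) := mul_nonneg (hCPi L hL) (by positivity)
  have hK := supRow_KinvT_of_kernelRow i.1.1 i.1.2.1 i.1.2.2 i.2.2.le (c₀ L) (cB L) a (DeltaPiSlotP i.1.1 i.1.2.1 i.1.2.2 i.2.2.le (c₀ L) (cB L) a) U₀ hCK0 (hμPi L hL)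
    (hKπ L hL i U₀ ρ hreg (hρ.trans (hαMPi L)) hlift hroom a ha₀a ha₁a)
  have hCQ0 : 0 ≤ (2 * (Real.sqrt 2 * (2 * Real.exp ((159 * ((((3 : ℕ) + 2) * L : ℕ) : ℝ) * (2 * ((3 : ℕ) : ℝ))) / (((L : ℝ) ^ (3 : ℕ))⁻¹ * (L : ℝ)) * (((((3 : ℕ) + 2) * L : ℕ) : ℝ) ^ 2 / 16 * αM L)) + 1))
            * (cB L / c₀ L) * ((L : ℝ) ^ (i.1.2.2 - i.1.2.1))⁻¹ ^ 3) := by positivity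
  have main := gradient_row_HT_of_gradient_row U₀ _ hpπ hCQ0 hG hQ hK b
  refine main.trans (mul_le_mul_of_nonneg_right (le_of_eq ?_) (norm_nonneg _))
  -- the K-free product: `(cB∕c₀)ℓ⁻³ · (c₀∕cB)ℓ³ = 1`
  have hℓ : (L : ℝ) ^ (i.1.2.2 - i.1.2.1) ≠ 0 := pow_ne_zero _ hL0.ne'
  field_simp

/-! ## §3 ★★★ S47's row `norm_Hπ` for all members -/

/-- ★★★ **THE S47 ROW `norm_Hπ` FOR ALL MEMBERS AS ONE `∃`-PACKAGE (the row (2) socket)** — px21's Hπ-DOOR member lemma ✓`norm_H1f_le_of_kernelRow_of_gradLetter` at every member over px10's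
row (1) package ✓`h133_family_exists` and §2's `hGπ` family; `B₀ L := max (3·CH L·(2(1+1∕(δH L∕2)))³) (MG L)`; antecedents = ✓`h133_family_exists`' VERBATIM (`RegPr`, cap, `Lift`, ROOM,
coupling window). [cite: Balaban1985BackgroundPropagators, (3.126) p.420, (3.133) p.422, Thm 3.12 (3.42) p.423; Balaban1985Variational, Thm 1 p.279, (103) p.293, (115)–(117) pp.294–295] -/
theorem normHpi_family_exists [hFL : ∀ F : T3Family, Fact (0 < (F.L : ℝ))] [hFη : ∀ (F : T3Family) (k : ℕ), Fact (0 < ((F.L : ℝ)⁻¹) ^ k)]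
    (c₀ cB : ℕ → ℝ) [hc₀ : ∀ L : ℕ, Fact (0 < c₀ L)] [hcB : ∀ L : ℕ, Fact (0 < cB L)] {a₀ a₁ : ℝ} (ha₀ : 0 < a₀) (ha₀₁ : a₀ ≤ a₁) :
    ∃ (αM MG : ℕ → ℝ),
      (∀ L : ℕ, 1 < L → 0 < αM L) ∧ (∀ L : ℕ, 1 < L → 10 ^ 12 * (L : ℝ) ^ 3 * αM L ≤ 1) ∧ (∀ L : ℕ, 1 < L → 10 ^ 10 * (L : ℝ) ^ 6 * αM L ≤ 1) ∧
      (∀ L : ℕ, 1 < L → 13 * 10 ^ 14 * (L : ℝ) ^ 3 * αM L ≤ 1) ∧ (∀ L : ℕ, 1 < L → αM L ≤ 1) ∧ (∀ L : ℕ, 1 < L → 0 ≤ MG L) ∧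
    ∀ (L : ℕ), 1 < L → ∀ (i : T3Thm1Carrier.Idx L) (U₀ : GaugeField (i.1.1.P i.1.2.2) 0 (Matrix.specialUnitaryGroup (Fin 2) ℂ)), ∀ ρ : ℝ, RegPr i.1.1 i.1.2.1 i.1.2.2 ρ U₀ → ρ ≤ αM L →
        (∀ cf : Site (i.1.1.P i.1.2.2) (i.1.2.2 - i.1.2.1) → Matrix (Fin 2) (Fin 2) ℂ,
        (∀ e' : PBond (i.1.1.P i.1.2.2) (i.1.2.2 - i.1.2.1), cf e'.src = ((emlIterU (i.1.2.2 - i.1.2.1) (bgUnits i.1.1 i.1.2.2 U₀) e' : (Matrix (Fin 2) (Fin 2) ℂ)ˣ) : Matrix (Fin 2) (Fin 2) ℂ) * cf e'.tgt *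
        (((emlIterU (i.1.2.2 - i.1.2.1) (bgUnits i.1.1 i.1.2.2 U₀) e')⁻¹ : (Matrix (Fin 2) (Fin 2) ℂ)ˣ) : Matrix (Fin 2) (Fin 2) ℂ)) →
        ∃ l₀ : Site (i.1.1.P i.1.2.2) 0 → Matrix (Fin 2) (Fin 2) ℂ,
        (∀ b' : PBond (i.1.1.P i.1.2.2) 0, l₀ b'.src = ((bgUnits i.1.1 i.1.2.2 U₀ b' : (Matrix (Fin 2) (Fin 2) ℂ)ˣ) : Matrix (Fin 2) (Fin 2) ℂ) * l₀ b'.tgt * (((bgUnits i.1.1 i.1.2.2 U₀ b')⁻¹ : (Matrix (Fin 2) (Fin 2) ℂ)ˣ) : Matrix (Fin 2) (Fin 2) ℂ)) ∧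
        ∀ y : Site (i.1.1.P i.1.2.2) (i.1.2.2 - i.1.2.1), l₀ (embIter (i.1.2.2 - i.1.2.1) y) = cf y) →
      2 * (12 * i.1.1.L ^ (i.1.2.2 - i.1.2.1) + 5) ≤ (i.1.1.P i.1.2.2).sitesPerDir 0 →
      ∀ a : ℝ, a₀ * (c₀ L / cB L) * ((i.1.1.L : ℝ) ^ (i.1.2.2 - i.1.2.1)) ^ 3 ≤ a → a ≤ a₁ * (c₀ L / cB L) * ((i.1.1.L : ℝ) ^ (i.1.2.2 - i.1.2.1)) ^ 3 →
      ∀ b : PBond (i.1.1.P i.1.2.1) 0 → Matrix (Fin 2) (Fin 2) ℂ,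
        ‖H1f i.1.1 i.1.2.1 i.1.2.2 i.2.2.le (c₀ L) (cB L) a (DeltaPiSlotP i.1.1 i.1.2.1 i.1.2.2 i.2.2.le (c₀ L) (cB L) a) U₀ b‖ ≤ MG L * ‖b‖ := by
  classical
  obtain ⟨αH, CH, δH, hαH, hWH12, hWH10, hWH13, hαH1, hCH, hδH, h133⟩ := h133_family_exists c₀ cB ha₀ ha₀₁
  obtain ⟨αG, MG, hαG, hWG12, hWG10, hWG13, hαG1, hMG, hGπ⟩ := hGpi_family_exists c₀ cB ha₀ ha₀₁
  set αN : ℕ → ℝ := fun L => min (αH L) (αG L) with hαN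
  have hαN0 : ∀ L : ℕ, 1 < L → 0 < αN L := fun L hL => lt_min (hαH L hL) (hαG L hL)
  refine ⟨αN, fun L => max (3 * CH L * (2 * (1 + 1 / (δH L / 2))) ^ 3) (MG L), hαN0, fun L hL => ?_, fun L hL => ?_, fun L hL => ?_,
    fun L hL => (min_le_left _ _).trans (hαH1 L hL), fun L hL => le_max_of_le_right (hMG L hL), ?_⟩
  · exact (mul_le_mul_of_nonneg_left (min_le_left _ _) (by positivity)).trans (hWH12 L hL)
  · exact (mul_le_mul_of_nonneg_left (min_le_left _ _) (by positivity)).trans (hWH10 L hL)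
  · exact (mul_le_mul_of_nonneg_left (min_le_left _ _) (by positivity)).trans (hWH13 L hL)
  intro L hL i U₀ ρ hreg hρ hlift hroom a ha₀a ha₁a b
  have hδ2 : 0 < δH L / 2 := half_pos (hδH L hL)
  haveI : Fact (0 < (i.1.1.L : ℝ)) := hFL i.1.1
  haveI : Fact (0 < ((i.1.1.L : ℝ)⁻¹) ^ (i.1.2.2 - i.1.2.1)) := hFη i.1.1 _
  refine norm_H1f_le_of_kernelRow_of_gradLetter i.1.1 i.1.2.1 i.1.2.2 i.2.2.le (c₀ L) (cB L) a
    (DeltaPiSlotP i.1.1 i.1.2.1 i.1.2.2 i.2.2.le (c₀ L) (cB L) a) U₀ (hCH L hL) hδ2 (fun y Z bd => ?_)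
    (hGπ L hL i U₀ ρ hreg (hρ.trans (min_le_right _ _)) hlift hroom a ha₀a ha₁a) b
  have h := h133 L hL i U₀ ρ hreg (hρ.trans (min_le_left _ _)) hlift hroom a ha₀a ha₁a y Z (bondEquiv i.1.1 i.1.2.2 bd)
  rwa [flat115_H1f_apply, Equiv.symm_apply_apply] at h

end Summit.QuantumFields.YangMills.Theorems.Prop7NormHpiFamilyPackage

end
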